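import Mathlib.Analysis.SpecialFunctions.Complex.LogDeriv
import Literature.Probability.RandomPlanarGeometry.RestrictionSemigroup
import Literature.Probability.RandomPlanarGeometry.RestrictionPullback
import Literature.Probability.RandomPlanarGeometry.LoewnerInverse
import Literature.Probability.RandomPlanarGeometry.LoewnerMapProofs
import HarnessLib

/-!
# The Loewner semigroup `G_t` of [LSW] Prop. 3.3

G. F. Lawler, O. Schramm, W. Werner, *Conformal restriction: the chordal case*, J. Amer. Math.
Soc. **16** (2003) 917–955, arXiv:math/0209343 (**[LSW]**), proof of Prop. 3.3, p. 11:

> "Let `G_t(z)` be the solution of the initial value problem `∂_t G_t(z) = 2 G_t(z)/(G_t(z) - 1)`,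
> `G_0(z) = z`. Note that this function can equivalently be defined as
> `G_t(z) = g_t(z) - g_t(0) = g_t(z) + 2t`, where `(g_t)` is the chordal Loewner chain driven by
> the function `W_t = 1 - 2t`. Hence, `G_t` is the unique conformal map from `ℍ ∖ K_t` onto `ℍ`
> such that `G_t(0) = 0` and `G_t(z)/z → 1` when `z → ∞`. (Here, `K_t` is the evolving hull of
> `g_t`.) Also … one has `G_t ∘ G_s = G_{t+s}` in `ℍ ∖ K_{t+s}`, for all `s, t ≥ 0`. …
> Differentiating with respect to `z` gives `G_t'(0) = exp(-2t)`. … Since `⋂_{t>0} K_t = {1}` …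
> Now, set `G_t^λ(z) = λ G_t(λ⁻¹ z)`, `λ > 0`. Then `G_t^λ : ℍ ∖ λK_t → ℍ` is a suitably
> normalized conformal map."

Everything in this paragraph is PROVED here from the tree's chordal Loewner theory
(`LoewnerChain`, `LoewnerFlow`, `LoewnerGrowth`, `LoewnerMapProofs`; Lawler (2005), Ch. 4 §4.1)
for the explicit driving function `lswDriving t = 1 - 2t`:

* `lswHull t` (`K_t`, the closure of the Loewner hull) is a `+`-hull (`isPlusHull_lswHull`),
  non-empty for `t > 0`, contained in `closedBall 1 (2t + 4√t)` (so `K_t → {1}`), increasing;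
* `lswMap t` (`G_t = g_t + 2t`) is a restriction map of `K_t` (`isRestrictionMap_lswMap`) with
  `Φ'_{K_t}(0) = e^{-2t}` (`hasRestrictionDeriv_lswMap`; proof by the conserved quantity
  `G - log G = z - log z + 2t` along the flow, no differentiation in `z` needed);
* the semigroup law `G_{s+t} = G_t ∘ G_s` and its hull form `K_{s+t} = K_t · K_s`
  (`lswMap_add`, `isHullProduct_lswHull`);
* dilations: for `A ∈ 𝒬*` with restriction map `Φ` and `r > 0`, `z ↦ r Φ(z/r)` is a
  restriction map of `r A` with the same `Φ'(0)` (`IsRestrictionMap.smulHull`,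
  `HasRestrictionDeriv.smulHull`), so `Φ'_{λK_t}(0) = e^{-2t}` as well.

## References

* [LSW] G. F. Lawler, O. Schramm, W. Werner, JAMS 16 (2003), proof of Prop. 3.3 (arXiv p. 11).
* G. F. Lawler, *Conformally Invariant Processes in the Plane*, AMS (2005), Ch. 4 §4.1.
-/

noncomputable section

open Set Filter Topology Metric Complex Bornology
open UpperHalfPlane (upperHalfPlaneSet isOpen_upperHalfPlaneSet)
open scoped NNReal Pointwise

namespace Literature.Probability.RandomPlanarGeometry

open Loewner

/-! ### The driving function `W_t = 1 - 2t` and the flow of the origin -/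

/-- The driving function `W_t = 1 - 2t` of the [LSW] semigroup.
[cite: LawlerSchrammWerner2003Restriction, Prop. 3.3 proof (p. 11)] -/
def lswDriving : ℝ≥0 → ℝ := fun t ↦ 1 - 2 * t

/-- `W_t = 1 - 2t`. [folklore] -/
@[simp] theorem lswDriving_apply (t : ℝ≥0) : lswDriving t = 1 - 2 * t := rfl

/-- `W_0 = 1`. [folklore] -/
theorem lswDriving_zero : lswDriving 0 = 1 := by simp

/-- `W` is continuous. [folklore] -/
theorem continuous_lswDriving : Continuous lswDriving :=
  continuous_const.sub (continuous_const.mul NNReal.continuous_coe)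

/-- Time shifts of `W` are translates: `W (s + u) = W u + (-2s)`. [folklore] -/
theorem lswDriving_add (s u : ℝ≥0) : lswDriving (s + u) = lswDriving u + (-2 * (s : ℝ)) := by
  simp only [lswDriving_apply, NNReal.coe_add]
  ring

/-- `|W_s - W_0| ≤ 2t` for `s ≤ t`. [folklore] -/
theorem abs_lswDriving_sub_le {s t : ℝ≥0} (hs : s ≤ t) : |lswDriving s - lswDriving 0| ≤ 2 * t := by
  have h : lswDriving s - lswDriving 0 = -(2 * (s : ℝ)) := by simp
  rw [h, abs_neg, abs_of_nonneg (by positivity)]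
  exact mul_le_mul_of_nonneg_left (NNReal.coe_le_coe.2 hs) (by norm_num)

/-- **The origin flows for ever: `g_t(0) = -2t`** is a global solution of the Loewner equation
driven by `W_t = 1 - 2t` (`ġ = 2/(g - W) = 2/(-1) = -2`).
[cite: LawlerSchrammWerner2003Restriction, Prop. 3.3 proof (p. 11)] -/
theorem isSolution_lsw_zero :
    IsSolution lswDriving 0 (fun s : ℝ ↦ ((-2 * s : ℝ) : ℂ)) ⊤ := by
  refine ⟨by simp, fun s hs ↦ ?_, fun s hs _ h ↦ ?_⟩
  · have hval : vectorField lswDriving s ((-2 * s : ℝ) : ℂ) = -2 := by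
      rw [vectorField_apply, lswDriving_apply, Real.coe_toNNReal _ hs.1]
      push_cast
      have : (-2 * (s : ℂ) - (1 - 2 * (s : ℂ))) = -1 := by ring
      rw [this]
      norm_num
    rw [hval]
    have h1 : HasDerivAt (fun s : ℝ ↦ ((-2 * s : ℝ) : ℂ)) (-2) s := by
      have := ((hasDerivAt_id s).const_mul (-2 : ℝ)).ofReal_comp
      simpa using this
    exact h1.hasDerivWithinAt
  · rw [lswDriving_apply, Real.coe_toNNReal _ hs] at h
    have := congrArg Complex.re h
    simp at this
    linarith

/-- The swallowing time of the origin is infinite. [folklore] -/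
theorem swallowingTime_lsw_zero : swallowingTime lswDriving 0 = ⊤ :=
  le_antisymm le_top isSolution_lsw_zero.le_swallowingTime

/-- `g_t(0) = -2t`. [cite: LawlerSchrammWerner2003Restriction, Prop. 3.3 proof (p. 11)] -/
theorem map_lsw_zero (t : ℝ≥0) : map lswDriving t 0 = ((-2 * t : ℝ) : ℂ) := by
  have ht : (t : WithTop ℝ≥0) < (⊤ : WithTop ℝ≥0) := WithTop.coe_lt_top t
  exact map_eq_of_isSolution continuous_lswDriving isSolution_lsw_zero ht

/-- Non-positive real points are never swallowed (they lie to the left of the origin, which is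
to the left of the driving point and flows for ever; `swallowingTime_mono_left`). [folklore] -/
theorem swallowingTime_lsw_of_nonpos {x : ℝ} (hx : x ≤ 0) : swallowingTime lswDriving x = ⊤ := by
  have h0 : ((0 : ℝ) : ℝ) < lswDriving 0 := by simp
  have h := swallowingTime_mono_left continuous_lswDriving h0 hx
  rw [Complex.ofReal_zero, swallowingTime_lsw_zero, top_le_iff] at h
  exact h

/-! ### The hulls `K_t` -/

/-- **The hull `K_t`** of the [LSW] semigroup: the closure of the Loewner hull at time `t` of
the driving function `W_t = 1 - 2t` (a compact subset of `ℍ̄` with `K_t ∩ ℍ` the Loewner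
hull). [cite: LawlerSchrammWerner2003Restriction, Prop. 3.3 proof (p. 11)] -/
def lswHull (t : ℝ≥0) : Set ℂ := closure (hull lswDriving t)

/-- Points still flowing at time `t` are off `K_t` (the set `{t < T_z}` is an open
neighbourhood disjoint from the Loewner hull). [folklore] -/
theorem notMem_lswHull_of_lt_swallowingTime {t : ℝ≥0} {z : ℂ}
    (hz : (t : WithTop ℝ≥0) < swallowingTime lswDriving z) : z ∉ lswHull t := by
  intro hmem
  rw [lswHull, mem_closure_iff_nhds] at hmem
  obtain ⟨w, hw, hwt⟩ := hmem _
    ((isOpen_setOf_lt_swallowingTime continuous_lswDriving t).mem_nhds hz)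
  exact absurd hwt.2 (not_le.2 hw)

/-- `K_t ∩ ℍ` is the Loewner hull. [folklore] -/
theorem lswHull_inter (t : ℝ≥0) : lswHull t ∩ upperHalfPlaneSet = hull lswDriving t := by
  refine Subset.antisymm ?_ fun z hz ↦ ⟨subset_closure hz, hz.1⟩
  rintro z ⟨hz, hzH⟩
  by_contra hzK
  have hdom : z ∈ domain lswDriving t := ⟨hzH, hzK⟩
  exact notMem_lswHull_of_lt_swallowingTime ((mem_domain_iff _ _ _).1 hdom).2 hz

/-- `ℍ ∖ K_t` is the Loewner domain `H_t`. [folklore] -/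
theorem diff_lswHull (t : ℝ≥0) : upperHalfPlaneSet \ lswHull t = domain lswDriving t := by
  ext z
  constructor
  · rintro ⟨hzH, hzK⟩
    exact ⟨hzH, fun h ↦ hzK (subset_closure h)⟩
  · rintro ⟨hzH, hzK⟩
    refine ⟨hzH, fun h ↦ hzK ?_⟩
    rw [← lswHull_inter]
    exact ⟨h, hzH⟩

/-- `K_t ⊆ closedBall 1 (2t + 4√t)`: the hulls shrink to the point `1` as `t → 0`
(Lawler (2005), Lemma 4.13, `hull_subset_closedBall_driving`).
[cite: LawlerSchrammWerner2003Restriction, Prop. 3.3 proof (p. 11)] -/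
theorem lswHull_subset_closedBall (t : ℝ≥0) :
    lswHull t ⊆ closedBall (1 : ℂ) (2 * t + 4 * Real.sqrt t) := by
  have h := hull_subset_closedBall_driving continuous_lswDriving (u := t) (S := 2 * t)
    (fun s hs ↦ abs_lswDriving_sub_le hs)
  rw [lswDriving_zero, Complex.ofReal_one] at h
  exact closure_minimal h isClosed_closedBall

/-- `K_t` is bounded. [folklore] -/
theorem isBounded_lswHull (t : ℝ≥0) : IsBounded (lswHull t) :=
  isBounded_closedBall.subset (lswHull_subset_closedBall t)

/-- `K_t` is closed. [folklore] -/
theorem isClosed_lswHull (t : ℝ≥0) : IsClosed (lswHull t) := isClosed_closure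

/-- `K_t ⊆ ℍ̄`. [folklore] -/
theorem lswHull_subset_closure (t : ℝ≥0) : lswHull t ⊆ closure upperHalfPlaneSet :=
  closure_mono (hull_subset _ _)

/-- `0 ∉ K_t`. [cite: LawlerSchrammWerner2003Restriction, Prop. 3.3 proof (p. 11)] -/
theorem zero_notMem_lswHull (t : ℝ≥0) : (0 : ℂ) ∉ lswHull t :=
  notMem_lswHull_of_lt_swallowingTime (by rw [swallowingTime_lsw_zero]; exact WithTop.coe_lt_top t)

/-- Real points of `K_t` are positive. [folklore] -/
theorem pos_of_ofReal_mem_lswHull {t : ℝ≥0} {x : ℝ} (hx : (x : ℂ) ∈ lswHull t) : 0 < x := by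
  by_contra hle
  rw [not_lt] at hle
  exact notMem_lswHull_of_lt_swallowingTime
    (by rw [swallowingTime_lsw_of_nonpos hle]; exact WithTop.coe_lt_top t) hx

/-- The hulls increase. [folklore] -/
theorem lswHull_mono : Monotone lswHull := fun _ _ hst ↦ closure_mono (hull_mono _ hst)

/-- `K_t ∩ ℍ ≠ ∅` for `t > 0`. [folklore] -/
theorem lswHull_inter_nonempty {t : ℝ≥0} (ht : 0 < t) : (lswHull t ∩ upperHalfPlaneSet).Nonempty := by
  rw [lswHull_inter]
  exact hull_nonempty continuous_lswDriving ht

/-- **`K_t` is a bounded hull** (`K_t ∈ 𝒬`): bounded, the closure of its part in `ℍ`, and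
`ℍ ∖ K_t = H_t` is simply connected, being conformally equivalent to `ℍ` by the Loewner map.
[cite: LawlerSchrammWerner2003Restriction, Prop. 3.3 proof (p. 11)] -/
theorem isBoundedHull_lswHull (t : ℝ≥0) : IsBoundedHull (lswHull t) := by
  refine ⟨isBounded_lswHull t, by rw [lswHull_inter, lswHull], ?_⟩
  rw [diff_lswHull]
  exact (conformalEquivMap continuous_lswDriving t).isSimplyConnected_iff.2
    isSimplyConnected_upperHalfPlaneSet

/-- `K_t ∈ 𝒬*`. [cite: LawlerSchrammWerner2003Restriction, Prop. 3.3 proof (p. 11)] -/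
theorem isStarHull_lswHull (t : ℝ≥0) : IsStarHull (lswHull t) :=
  ⟨isBoundedHull_lswHull t, zero_notMem_lswHull t⟩

/-- **`K_t ∈ 𝒬₊`.** [cite: LawlerSchrammWerner2003Restriction, Prop. 3.3 proof (p. 11)] -/
theorem isPlusHull_lswHull (t : ℝ≥0) : IsPlusHull (lswHull t) :=
  ⟨isStarHull_lswHull t, fun _ hx ↦ pos_of_ofReal_mem_lswHull hx⟩

/-! ### The maps `G_t = g_t + 2t` -/

/-- **The map `G_t = g_t - g_t(0) = g_t + 2t`** of the [LSW] semigroup, as a conformal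
equivalence `ℍ ∖ K_t → ℍ` (the Loewner map `g_t : H_t → ℍ` of the tree, `conformalEquivMap`,
followed by the translation by `2t = -g_t(0)`).
[cite: LawlerSchrammWerner2003Restriction, Prop. 3.3 proof (p. 11)] -/
def lswMap (t : ℝ≥0) : ConformalEquiv (upperHalfPlaneSet \ lswHull t) upperHalfPlaneSet :=
  ((conformalEquivMap continuous_lswDriving t).trans
    (addRealUpperHalfPlane (2 * t))).copy
    (upperHalfPlaneSet \ lswHull t) upperHalfPlaneSet (diff_lswHull t) rfl

/-- `G_t(z) = g_t(z) + 2t`. [folklore] -/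
@[simp] theorem lswMap_apply (t : ℝ≥0) (z : ℂ) :
    lswMap t z = map lswDriving t z + 2 * ((t : ℝ) : ℂ) := by
  simp only [lswMap, ConformalEquiv.copy_apply, ConformalEquiv.trans_apply, conformalEquivMap_apply,
    addRealUpperHalfPlane_apply]
  push_cast
  ring

/-- `G_t(0) = 0` (value of the formula at the origin, which flows for ever). [folklore] -/
theorem lswMap_zero (t : ℝ≥0) : lswMap t 0 = 0 := by
  rw [lswMap_apply, map_lsw_zero]
  push_cast
  ring

/-- `G_t` maps `ℍ ∖ K_t` into `ℍ`. [folklore] -/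
theorem lswMap_mem {t : ℝ≥0} {z : ℂ} (hz : z ∈ upperHalfPlaneSet \ lswHull t) :
    lswMap t z ∈ upperHalfPlaneSet :=
  (lswMap t).mapsTo hz

/-- **`G_t` is a restriction map of `K_t`**: boundary value `0` at `0` (continuity of the flow at
the origin, `g_t(0) = -2t`) and `G_t(z)/z → 1` at `∞` (hydrodynamic normalisation
`g_t(z) - z → 0`). [cite: LawlerSchrammWerner2003Restriction, Prop. 3.3 proof (p. 11)] -/
theorem isRestrictionMap_lswMap (t : ℝ≥0) : IsRestrictionMap (lswHull t) (lswMap t) := by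
  refine ⟨?_, ?_⟩
  · change Tendsto (lswMap t) (𝓝[upperHalfPlaneSet \ lswHull t] 0) (𝓝 0)
    have hc : ContinuousAt (map lswDriving t) 0 :=
      continuousAt_map continuous_lswDriving
        (by rw [swallowingTime_lsw_zero]; exact WithTop.coe_lt_top t)
    have h1 : Tendsto (fun z ↦ map lswDriving t z + 2 * ((t : ℝ) : ℂ)) (𝓝 0)
        (𝓝 (map lswDriving t 0 + 2 * ((t : ℝ) : ℂ))) :=
      hc.tendsto.add tendsto_const_nhds
    have h0 : map lswDriving t 0 + 2 * ((t : ℝ) : ℂ) = 0 := by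
      rw [map_lsw_zero]
      push_cast
      ring
    rw [h0] at h1
    refine (h1.mono_left nhdsWithin_le_nhds).congr fun z ↦ ?_
    rw [lswMap_apply]
  · have hF : cocompact ℂ ⊓ 𝓟 (upperHalfPlaneSet \ lswHull t) ≤ cocompact ℂ ⊓ 𝓟 upperHalfPlaneSet :=
      inf_le_inf_left _ (principal_mono.2 sdiff_subset)
    have h1 : Tendsto (fun z ↦ map lswDriving t z - z)
        (cocompact ℂ ⊓ 𝓟 (upperHalfPlaneSet \ lswHull t)) (𝓝 0) :=
      (tendsto_map_sub_self_holds continuous_lswDriving t).mono_left hF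
    have h2 : Tendsto (fun z ↦ map lswDriving t z - z + 2 * ((t : ℝ) : ℂ))
        (cocompact ℂ ⊓ 𝓟 (upperHalfPlaneSet \ lswHull t)) (𝓝 (0 + 2 * ((t : ℝ) : ℂ))) :=
      h1.add tendsto_const_nhds
    have h3 : Tendsto (fun z : ℂ ↦ z⁻¹) (cocompact ℂ ⊓ 𝓟 (upperHalfPlaneSet \ lswHull t)) (𝓝 0) := by
      refine Tendsto.mono_left ?_ inf_le_left
      rw [← cobounded_eq_cocompact]
      exact tendsto_inv₀_cobounded
    have h4 := (h2.mul h3).const_add 1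
    rw [mul_zero, add_zero] at h4
    refine h4.congr' ?_
    have hev : ∀ᶠ z : ℂ in cocompact ℂ ⊓ 𝓟 (upperHalfPlaneSet \ lswHull t), z ≠ 0 :=
      mem_inf_of_left (isCompact_singleton.compl_mem_cocompact)
    filter_upwards [hev] with z hz
    rw [lswMap_apply]
    field_simp
    ring

/-- **The conserved quantity `G_t(z) - log G_t(z) = z - log z + 2t`** along the flow of a
point of `ℍ ∖ K_t` (principal logarithm; the flow stays in `ℍ`): the time derivative of
`G - log G` is `Ġ (1 - 1/G) = (2G/(G - 1)) ((G - 1)/G) = 2`. This replaces "differentiating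
(3.2) with respect to `z`". [cite: LawlerSchrammWerner2003Restriction, Prop. 3.3 proof (p. 11)] -/
theorem lswMap_sub_log {t : ℝ≥0} {z : ℂ} (hz : z ∈ upperHalfPlaneSet \ lswHull t) :
    lswMap t z - log (lswMap t z) = z - log z + 2 * ((t : ℝ) : ℂ) := by
  rw [diff_lswHull, mem_domain_iff] at hz
  obtain ⟨hzH, hzt⟩ := hz
  have hz0 : z ≠ lswDriving 0 := ne_driving_of_lt_swallowingTime hzt
  obtain ⟨g, hg⟩ := exists_isSolution_swallowingTime_holds continuous_lswDriving hz0
  have htT : ((t : ℝ).toNNReal : WithTop ℝ≥0) < swallowingTime lswDriving z := by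
    rwa [Real.toNNReal_coe]
  have hsub : Icc (0 : ℝ) t ⊆
      {s : ℝ | 0 ≤ s ∧ (s.toNNReal : WithTop ℝ≥0) < swallowingTime lswDriving z} :=
    Icc_subset_timeDomain htT
  have him : ∀ s ∈ Icc (0 : ℝ) t, 0 < (g s).im := fun s hs ↦
    IsSolution.im_pos_holds continuous_lswDriving hg hzH s hs.1 (hsub hs).2
  have hslit : ∀ s ∈ Icc (0 : ℝ) t, g s + 2 * (s : ℂ) ∈ slitPlane := fun s hs ↦ by
    refine Or.inr ?_
    have : (g s + 2 * (s : ℂ)).im = (g s).im := by simp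
    rw [this]
    exact (him s hs).ne'
  have hne1 : ∀ s ∈ Icc (0 : ℝ) t, g s + 2 * (s : ℂ) - 1 ≠ 0 := fun s hs h ↦ by
    have h1 := hg.ne hs.1 (hsub hs).2
    apply h1
    rw [lswDriving_apply, Real.coe_toNNReal _ hs.1]
    push_cast
    linear_combination h
  have hne0 : ∀ s ∈ Icc (0 : ℝ) t, g s + 2 * (s : ℂ) ≠ 0 := fun s hs ↦
    slitPlane_ne_zero (hslit s hs)
  set Q : ℝ → ℂ := fun s ↦ (g s + 2 * (s : ℂ)) - log (g s + 2 * (s : ℂ)) - 2 * (s : ℂ) with hQ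
  -- continuity of `Q` on `[0, t]`
  have hGc : ContinuousOn (fun s : ℝ ↦ g s + 2 * (s : ℂ)) (Icc 0 t) :=
    (hg.continuousOn.mono hsub).add (continuous_const.mul Complex.continuous_ofReal).continuousOn
  have hcont : ContinuousOn Q (Icc 0 t) := by
    refine (hGc.sub (hGc.clog fun s hs ↦ hslit s hs)).sub
      (continuous_const.mul Complex.continuous_ofReal).continuousOn
  -- the derivative of `Q` vanishes
  have hderiv : ∀ s ∈ Ico (0 : ℝ) t, HasDerivWithinAt Q 0 (Ici s) s := by
    intro s hs
    have hs' : s ∈ Icc (0 : ℝ) t := ⟨hs.1, hs.2.le⟩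
    set G : ℂ := g s + 2 * (s : ℂ) with hGdef
    have hg' : HasDerivWithinAt g (vectorField lswDriving s (g s)) (Ici s) s :=
      hg.hasDerivWithinAt_Ici hsub s hs
    have hvf : vectorField lswDriving s (g s) = 2 / (G - 1) := by
      rw [vectorField_apply, lswDriving_apply, Real.coe_toNNReal _ hs.1, hGdef]
      push_cast
      ring_nf
    rw [hvf] at hg'
    have h2 : HasDerivWithinAt (fun u : ℝ ↦ 2 * (u : ℂ)) 2 (Ici s) s := by
      have := ((hasDerivAt_id s).ofReal_comp.const_mul (2 : ℂ)).hasDerivWithinAt (s := Ici s)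
      simpa using this
    have hG' : HasDerivWithinAt (fun u : ℝ ↦ g u + 2 * (u : ℂ)) (2 / (G - 1) + 2) (Ici s) s :=
      hg'.add h2
    have hlog : HasDerivWithinAt (log ∘ fun u : ℝ ↦ g u + 2 * (u : ℂ)) (G⁻¹ * (2 / (G - 1) + 2))
        (Ici s) s :=
      (Complex.hasDerivAt_log (hslit s hs')).comp_hasDerivWithinAt s hG'
    have hQ' := (hG'.sub hlog).sub h2
    have hzero : 2 / (G - 1) + 2 - G⁻¹ * (2 / (G - 1) + 2) - 2 = 0 := by
      have h1 : G - 1 ≠ 0 := hne1 s hs'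
      have h0 : G ≠ 0 := hne0 s hs'
      field_simp
      ring
    rw [hzero] at hQ'
    exact hQ'
  have hconst := constant_of_has_deriv_right_zero hcont hderiv t ⟨t.coe_nonneg, le_rfl⟩
  -- evaluate at `t` and at `0`
  have hmap : map lswDriving t z = g t := map_eq_of_isSolution continuous_lswDriving hg hzt
  simp only [hQ, hg.apply_zero, Complex.ofReal_zero, mul_zero, add_zero, sub_zero] at hconst
  rw [lswMap_apply, hmap]
  linear_combination hconst

/-- `G_t(z)/z = exp (G_t(z) - z - 2t)` on `ℍ ∖ K_t` (exponentiate the conserved quantity).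
[cite: LawlerSchrammWerner2003Restriction, Prop. 3.3 proof (p. 11)] -/
theorem lswMap_div_eq {t : ℝ≥0} {z : ℂ} (hz : z ∈ upperHalfPlaneSet \ lswHull t) :
    lswMap t z / z = exp (lswMap t z - z - 2 * ((t : ℝ) : ℂ)) := by
  have hz0 : z ≠ 0 := ne_zero_of_mem_diff hz
  have hG0 : lswMap t z ≠ 0 := by
    intro h
    have := lswMap_mem hz
    rw [h] at this
    simp [upperHalfPlaneSet] at this
  have h := lswMap_sub_log hz
  have hlog : log (lswMap t z) = (lswMap t z - z - 2 * ((t : ℝ) : ℂ)) + log z := by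
    linear_combination -h
  calc lswMap t z / z = exp (log (lswMap t z)) / exp (log z) := by rw [exp_log hG0, exp_log hz0]
    _ = exp (log (lswMap t z) - log z) := by rw [exp_sub]
    _ = exp (lswMap t z - z - 2 * ((t : ℝ) : ℂ)) := by rw [hlog]; ring_nf

/-- **`Φ'_{K_t}(0) = G_t'(0) = e^{-2t}`.** [cite: LawlerSchrammWerner2003Restriction, Prop. 3.3 proof (p. 11)] -/
theorem hasRestrictionDeriv_lswMap (t : ℝ≥0) :
    HasRestrictionDeriv (lswHull t) (lswMap t) (Real.exp (-2 * t)) := by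
  change Tendsto (fun z ↦ lswMap t z / z) (𝓝[upperHalfPlaneSet \ lswHull t] 0)
    (𝓝 ((Real.exp (-2 * t) : ℝ) : ℂ))
  have h0 : Tendsto (lswMap t) (𝓝[upperHalfPlaneSet \ lswHull t] 0) (𝓝 0) :=
    (isRestrictionMap_lswMap t).1
  have h1 : Tendsto (fun z ↦ exp (lswMap t z - z - 2 * ((t : ℝ) : ℂ)))
      (𝓝[upperHalfPlaneSet \ lswHull t] 0) (𝓝 (exp (0 - 0 - 2 * ((t : ℝ) : ℂ)))) :=
    ((h0.sub (tendsto_id.mono_left nhdsWithin_le_nhds)).sub tendsto_const_nhds).cexp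
  have h2 : exp (0 - 0 - 2 * ((t : ℝ) : ℂ)) = ((Real.exp (-2 * t) : ℝ) : ℂ) := by
    rw [Complex.ofReal_exp]
    push_cast
    ring_nf
  rw [h2] at h1
  refine h1.congr' ?_
  filter_upwards [self_mem_nhdsWithin] with z hz
  exact (lswMap_div_eq hz).symm

/-- `0 < e^{-2t} ≤ 1`. [folklore] -/
theorem exp_neg_two_mul_pos (t : ℝ≥0) : 0 < Real.exp (-2 * t) := Real.exp_pos _

/-! ### Translating the driving function -/

namespace Loewner

variable {W : ℝ≥0 → ℝ}

/-- Hulls of a translated driving function are translated hulls (`swallowingTime_add_const`).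
[cite: Lawler2005, Ch. 4 §4.1] -/
theorem hull_add_const (W : ℝ≥0 → ℝ) (a : ℝ) (t : ℝ≥0) :
    hull (fun u ↦ W u + a) t = (fun z : ℂ ↦ z + a) '' hull W t := by
  ext w
  constructor
  · rintro ⟨hwH, hwT⟩
    refine ⟨w - a, ⟨?_, ?_⟩, by ring⟩
    · change 0 < (w - (a : ℂ)).im
      simpa using hwH
    · rw [← swallowingTime_add_const W (w - a) a]
      simpa using hwT
  · rintro ⟨z, ⟨hzH, hzT⟩, rfl⟩
    refine ⟨?_, ?_⟩
    · change 0 < (z + (a : ℂ)).im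
      simpa using hzH
    · change swallowingTime (fun u ↦ W u + a) (z + a) ≤ t
      rwa [swallowingTime_add_const]

/-- Loewner maps of a translated driving function are conjugated by the translation
(`IsSolution.add_const`). [cite: Lawler2005, Ch. 4 §4.1] -/
theorem map_add_const (hW : Continuous W) (a : ℝ) {t : ℝ≥0} {z : ℂ}
    (hz : (t : WithTop ℝ≥0) < swallowingTime W z) :
    map (fun u ↦ W u + a) t (z + a) = map W t z + a := by
  have hz0 : z ≠ W 0 := ne_driving_of_lt_swallowingTime hz
  obtain ⟨g, hg⟩ := exists_isSolution_swallowingTime_holds hW hz0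
  have hg' := hg.add_const a
  have hW' : Continuous fun s ↦ W s + a := hW.add continuous_const
  rw [map_eq_of_isSolution hW hg hz, map_eq_of_isSolution hW' hg' hz]

end Loewner

/-! ### The semigroup law `G_{s+t} = G_t ∘ G_s` and `K_{s+t} = K_t · K_s` -/

/-- The shifted driving function `W (s + ·)` is the translate `W + (-2s)`. [folklore] -/
theorem lswDriving_shift (s : ℝ≥0) :
    (fun u ↦ lswDriving (s + u)) = fun u ↦ lswDriving u + (-2 * (s : ℝ)) :=
  funext (lswDriving_add s)

/-- **The semigroup law `G_{s+t} = G_t ∘ G_s` on `ℍ ∖ K_{s+t}`** (the cocycle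
`g_{s+t} = g^{W(s+·)}_t ∘ g_s` of the Loewner flow, Lawler (2005) Rem. 4.9, and translation
invariance: `W (s + ·) = W - 2s`). [cite: LawlerSchrammWerner2003Restriction, Prop. 3.3 proof (p. 11)] -/
theorem lswMap_add {s t : ℝ≥0} {z : ℂ} (hz : z ∈ upperHalfPlaneSet \ lswHull (s + t)) :
    lswMap (s + t) z = lswMap t (lswMap s z) := by
  rw [diff_lswHull, mem_domain_iff] at hz
  obtain ⟨-, hzst⟩ := hz
  obtain ⟨hT', hmap⟩ := map_add continuous_lswDriving hzst
  rw [lswDriving_shift] at hT' hmap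
  have hw : map lswDriving s z =
      (map lswDriving s z + 2 * ((s : ℝ) : ℂ)) + ((-2 * (s : ℝ) : ℝ) : ℂ) := by
    push_cast
    ring
  have hT'' : (t : WithTop ℝ≥0) < swallowingTime lswDriving (map lswDriving s z + 2 * ((s : ℝ) : ℂ)) := by
    rw [hw, swallowingTime_add_const] at hT'
    exact hT'
  have key : map (fun u ↦ lswDriving u + (-2 * (s : ℝ))) t (map lswDriving s z) =
      map lswDriving t (map lswDriving s z + 2 * ((s : ℝ) : ℂ)) + ((-2 * (s : ℝ) : ℝ) : ℂ) := by
    conv_lhs => rw [hw]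
    exact Loewner.map_add_const continuous_lswDriving _ hT''
  rw [lswMap_apply, lswMap_apply, lswMap_apply, hmap, key]
  push_cast
  ring

/-- For `z ∈ ℍ ∖ K_s`: `z ∈ K_{s+t} ↔ G_s(z) ∈ K_t` (the cocycle on hulls,
`mem_hull_iff_map_mem_hull`). [cite: LawlerSchrammWerner2003Restriction, Prop. 3.3 proof (p. 11)] -/
theorem mem_lswHull_add_iff {s t : ℝ≥0} {z : ℂ} (hz : z ∈ upperHalfPlaneSet \ lswHull s) :
    z ∈ lswHull (s + t) ↔ lswMap s z ∈ lswHull t := by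
  have hzd : z ∈ domain lswDriving s := by rwa [← diff_lswHull]
  have h1 := mem_hull_iff_map_mem_hull continuous_lswDriving hzd (le_self_add : s ≤ s + t)
  rw [add_tsub_cancel_left, lswDriving_shift, Loewner.hull_add_const] at h1
  have hzK : z ∈ lswHull (s + t) ↔ z ∈ hull lswDriving (s + t) := by
    rw [← lswHull_inter]
    exact ⟨fun h ↦ ⟨h, hz.1⟩, fun h ↦ h.1⟩
  have hwK : lswMap s z ∈ lswHull t ↔ lswMap s z ∈ hull lswDriving t := by
    rw [← lswHull_inter]
    exact ⟨fun h ↦ ⟨h, lswMap_mem hz⟩, fun h ↦ h.1⟩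
  rw [hzK, hwK, h1, lswMap_apply]
  constructor
  · rintro ⟨w, hw, hw'⟩
    have : map lswDriving s z + 2 * ((s : ℝ) : ℂ) = w := by
      rw [← hw']
      push_cast
      ring
    rw [this]
    exact hw
  · intro h
    exact ⟨_, h, by push_cast; ring⟩

/-- `ℍ ∖ K_{s+t} = G_s⁻¹(ℍ ∖ K_t) = {z ∈ ℍ ∖ K_s | G_s(z) ∉ K_t}`.
[cite: LawlerSchrammWerner2003Restriction, Prop. 3.3 proof (p. 11)] -/
theorem diff_lswHull_add (s t : ℝ≥0) :
    upperHalfPlaneSet \ lswHull (s + t) =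
      {z | z ∈ upperHalfPlaneSet \ lswHull s ∧ lswMap s z ∉ lswHull t} := by
  ext z
  simp only [mem_setOf_eq]
  constructor
  · intro hz
    have hz' : z ∈ upperHalfPlaneSet \ lswHull s :=
      ⟨hz.1, fun h ↦ hz.2 (lswHull_mono (le_self_add : s ≤ s + t) h)⟩
    exact ⟨hz', fun h ↦ hz.2 ((mem_lswHull_add_iff hz').2 h)⟩
  · rintro ⟨hz', hno⟩
    exact ⟨hz'.1, fun h ↦ hno ((mem_lswHull_add_iff hz').1 h)⟩

/-- **`K_{s+t} = K_t · K_s`** in the sense of `RestrictionConfig.IsHullProduct` (with the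
restriction map `G_s` of `K_s`): `ℍ ∖ K_{s+t} = G_s⁻¹(ℍ ∖ K_t)`.
[cite: LawlerSchrammWerner2003Restriction, Prop. 3.3 proof (p. 11)] -/
theorem isHullProduct_lswHull (s t : ℝ≥0) :
    RestrictionConfig.IsHullProduct (lswHull t) (lswHull s) (lswHull (s + t)) :=
  ⟨isStarHull_lswHull _, lswMap s, isRestrictionMap_lswMap s, diff_lswHull_add s t⟩

/-- The same product with the factors named as in `hullProduct`: `K_{s+t}` is the constructed
product hull `K_t · K_s`. [cite: LawlerSchrammWerner2003Restriction, Prop. 3.3 proof (p. 11)] -/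
theorem hullProduct_lswHull (s t : ℝ≥0) :
    hullProduct (lswHull t) (lswHull s) (lswMap s) = lswHull (s + t) := by
  have h := diff_hullProduct (A := lswHull t) (A' := lswHull s) (Φ' := lswMap s)
    (isClosed_lswHull t) (isClosed_lswHull s)
  -- both are bounded hulls with the same complement in `ℍ`
  have hB := (isStarHull_lswHull t).hullProduct (isStarHull_lswHull s) (isRestrictionMap_lswMap s)
  have hdiff : upperHalfPlaneSet \ hullProduct (lswHull t) (lswHull s) (lswMap s) =
      upperHalfPlaneSet \ lswHull (s + t) := by
    rw [h, diff_lswHull_add]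
  have hint : hullProduct (lswHull t) (lswHull s) (lswMap s) ∩ upperHalfPlaneSet =
      lswHull (s + t) ∩ upperHalfPlaneSet := by
    ext z
    have h1 : z ∈ upperHalfPlaneSet \ hullProduct (lswHull t) (lswHull s) (lswMap s) ↔
        z ∈ upperHalfPlaneSet \ lswHull (s + t) := by rw [hdiff]
    simp only [Set.mem_sdiff, Set.mem_inter_iff] at h1 ⊢
    tauto
  rw [← hB.isBoundedHull.2.1, ← (isBoundedHull_lswHull (s + t)).2.1, hint]

/-! ### Dilations of hulls and restriction maps -/

section Smul

variable {A : Set ℂ} {Φ : ConformalEquiv (upperHalfPlaneSet \ A) upperHalfPlaneSet} {r : ℝ}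

/-- `z ∈ ℍ ∖ rA ↔ r⁻¹ z ∈ ℍ ∖ A` (`r > 0`). [folklore] -/
theorem mem_diff_smul_iff (hr : 0 < r) (z : ℂ) :
    z ∈ upperHalfPlaneSet \ r • A ↔ r⁻¹ • z ∈ upperHalfPlaneSet \ A := by
  have hH : z ∈ upperHalfPlaneSet ↔ r⁻¹ • z ∈ upperHalfPlaneSet := by
    rw [← Set.mem_smul_set_iff_inv_smul_mem₀ hr.ne', smul_upperHalfPlaneSet hr]
  rw [Set.mem_sdiff, Set.mem_sdiff, Set.mem_smul_set_iff_inv_smul_mem₀ hr.ne', hH]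

/-- The dilation `z ↦ r z` as a conformal equivalence `ℍ ∖ A → ℍ ∖ rA`. [folklore] -/
def ConformalEquiv.smulDiff (A : Set ℂ) (r : ℝ) (hr : 0 < r) :
    ConformalEquiv (upperHalfPlaneSet \ A) (upperHalfPlaneSet \ r • A) :=
  (ConformalEquiv.smulUpperHalfPlane r hr).restr (upperHalfPlaneSet \ A) (upperHalfPlaneSet \ r • A)
    sdiff_subset sdiff_subset
    (fun z hz ↦ by
      rw [ConformalEquiv.smulUpperHalfPlane_apply, mem_diff_smul_iff hr, smul_smul,
        inv_mul_cancel₀ hr.ne', one_smul]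
      exact hz)
    (fun w hw ↦ by
      rw [ConformalEquiv.smulUpperHalfPlane_symm_apply, ← mem_diff_smul_iff hr]
      exact hw)

/-- **The restriction map of a dilated hull**: `Φ_{rA}(z) = r Φ_A(z/r)` as a conformal
equivalence `ℍ ∖ rA → ℍ` ([LSW] p. 11: "`G_t^λ(z) = λG_t(λ⁻¹z)` … is a suitably normalized
conformal map" from `ℍ ∖ λK_t`). [cite: LawlerSchrammWerner2003Restriction, Prop. 3.3 proof (p. 11)] -/
def ConformalEquiv.smulHull (Φ : ConformalEquiv (upperHalfPlaneSet \ A) upperHalfPlaneSet)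
    (r : ℝ) (hr : 0 < r) : ConformalEquiv (upperHalfPlaneSet \ r • A) upperHalfPlaneSet :=
  ((ConformalEquiv.smulDiff A r hr).symm.trans Φ).trans (ConformalEquiv.smulUpperHalfPlane r hr)

/-- `Φ_{rA}(z) = r Φ_A(r⁻¹ z)`. [folklore] -/
@[simp] theorem ConformalEquiv.smulHull_apply (Φ : ConformalEquiv (upperHalfPlaneSet \ A) upperHalfPlaneSet)
    (hr : 0 < r) (z : ℂ) : Φ.smulHull r hr z = r • Φ (r⁻¹ • z) := rfl

/-- `z ↦ r⁻¹ z` tends to `0` within `ℍ ∖ A` as `z → 0` within `ℍ ∖ rA`. [folklore] -/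
theorem tendsto_inv_smul_nhdsWithin_diff (hr : 0 < r) :
    Tendsto (fun z : ℂ ↦ r⁻¹ • z) (𝓝[upperHalfPlaneSet \ r • A] 0)
      (𝓝[upperHalfPlaneSet \ A] 0) := by
  refine tendsto_nhdsWithin_of_tendsto_nhds_of_eventually_within _ ?_ ?_
  · have : Tendsto (fun z : ℂ ↦ r⁻¹ • z) (𝓝 0) (𝓝 (r⁻¹ • 0)) :=
      (continuous_const_smul r⁻¹).tendsto 0
    rw [smul_zero] at this
    exact this.mono_left nhdsWithin_le_nhds
  · filter_upwards [self_mem_nhdsWithin] with z hz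
    exact (mem_diff_smul_iff hr z).1 hz

/-- `z ↦ r⁻¹ z` tends to `∞` within `ℍ ∖ A` as `z → ∞` within `ℍ ∖ rA`. [folklore] -/
theorem tendsto_inv_smul_cocompact_diff (hr : 0 < r) :
    Tendsto (fun z : ℂ ↦ r⁻¹ • z) (cocompact ℂ ⊓ 𝓟 (upperHalfPlaneSet \ r • A))
      (cocompact ℂ ⊓ 𝓟 (upperHalfPlaneSet \ A)) := by
  refine Tendsto.inf ?_ (tendsto_principal_principal.2 fun z hz ↦ (mem_diff_smul_iff hr z).1 hz)
  have hr' : (r⁻¹ : ℂ) ≠ 0 := by exact_mod_cast inv_ne_zero hr.ne'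
  have h := (Homeomorph.mulLeft₀ (r⁻¹ : ℂ) hr').isClosedEmbedding.tendsto_cocompact
  refine h.congr fun z ↦ ?_
  simp [Complex.real_smul]

/-- `Φ_{rA}(z)/z = Φ_A(w)/w` with `w = r⁻¹ z`. [folklore] -/
theorem ConformalEquiv.smulHull_div (Φ : ConformalEquiv (upperHalfPlaneSet \ A) upperHalfPlaneSet)
    (hr : 0 < r) {z : ℂ} (hz : z ≠ 0) : Φ.smulHull r hr z / z = Φ (r⁻¹ • z) / (r⁻¹ • z) := by
  rw [ConformalEquiv.smulHull_apply, Complex.real_smul, Complex.real_smul]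
  have hr' : (r : ℂ) ≠ 0 := by exact_mod_cast hr.ne'
  push_cast
  field_simp

/-- **`z ↦ r Φ_A(z/r)` is a restriction map of `rA`.**
[cite: LawlerSchrammWerner2003Restriction, Prop. 3.3 proof (p. 11)] -/
theorem IsRestrictionMap.smulHull (hΦ : IsRestrictionMap A Φ) (hr : 0 < r) :
    IsRestrictionMap (r • A) (Φ.smulHull r hr) := by
  refine ⟨?_, ?_⟩
  · change Tendsto (Φ.smulHull r hr) (𝓝[upperHalfPlaneSet \ r • A] 0) (𝓝 0)
    have h1 : Tendsto (fun z ↦ Φ (r⁻¹ • z)) (𝓝[upperHalfPlaneSet \ r • A] 0) (𝓝 0) :=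
      hΦ.1.comp (tendsto_inv_smul_nhdsWithin_diff hr)
    have h2 : Tendsto (fun z ↦ r • Φ (r⁻¹ • z)) (𝓝[upperHalfPlaneSet \ r • A] 0) (𝓝 (r • 0)) :=
      h1.const_smul r
    rw [smul_zero] at h2
    exact h2
  · have h1 : Tendsto (fun z ↦ Φ (r⁻¹ • z) / (r⁻¹ • z))
        (cocompact ℂ ⊓ 𝓟 (upperHalfPlaneSet \ r • A)) (𝓝 1) :=
      hΦ.2.comp (tendsto_inv_smul_cocompact_diff hr)
    refine h1.congr' ?_
    have hev : ∀ᶠ z : ℂ in cocompact ℂ ⊓ 𝓟 (upperHalfPlaneSet \ r • A), z ≠ 0 :=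
      mem_inf_of_left (isCompact_singleton.compl_mem_cocompact)
    filter_upwards [hev] with z hz
    exact (Φ.smulHull_div hr hz).symm

/-- **`Φ'_{rA}(0) = Φ'_A(0)`** ([LSW] p. 11: "Since `Φ_{λA}'(0) = Φ_A'(0)` for `A ∈ 𝒬*`,
`λ > 0`"). [cite: LawlerSchrammWerner2003Restriction, Prop. 3.3 proof (p. 11)] -/
theorem HasRestrictionDeriv.smulHull (hr : 0 < r) {d : ℝ} (hd : HasRestrictionDeriv A Φ d) :
    HasRestrictionDeriv (r • A) (Φ.smulHull r hr) d := by
  change Tendsto (fun z ↦ Φ.smulHull r hr z / z) (𝓝[upperHalfPlaneSet \ r • A] 0) (𝓝 (d : ℂ))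
  have h1 : Tendsto (fun z ↦ Φ (r⁻¹ • z) / (r⁻¹ • z)) (𝓝[upperHalfPlaneSet \ r • A] 0)
      (𝓝 (d : ℂ)) :=
    hd.comp (tendsto_inv_smul_nhdsWithin_diff hr)
  refine h1.congr' ?_
  have hev : ∀ᶠ z : ℂ in 𝓝[upperHalfPlaneSet \ r • A] 0, z ≠ 0 := by
    filter_upwards [self_mem_nhdsWithin] with z hz
    exact ne_zero_of_mem_diff hz
  filter_upwards [hev] with z hz
  exact (Φ.smulHull_div hr hz).symm

end Smul

/-- **The generators `λK_t` of the semigroup `𝒜₀`**: `λK_t ∈ 𝒬*` has the restriction map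
`G_t^λ(z) = λG_t(z/λ)` with `Φ'_{λK_t}(0) = e^{-2t}`.
[cite: LawlerSchrammWerner2003Restriction, Prop. 3.3 proof (p. 11)] -/
theorem hasRestrictionDeriv_smul_lswHull {r : ℝ} (hr : 0 < r) (t : ℝ≥0) :
    IsStarHull (r • lswHull t) ∧ IsRestrictionMap (r • lswHull t) ((lswMap t).smulHull r hr) ∧
      HasRestrictionDeriv (r • lswHull t) ((lswMap t).smulHull r hr) (Real.exp (-2 * t)) :=
  ⟨(isStarHull_lswHull t).smul hr, (isRestrictionMap_lswMap t).smulHull hr,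
    (hasRestrictionDeriv_lswMap t).smulHull hr⟩

end Literature.Probability.RandomPlanarGeometry

end
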